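import Summits.Ventures.HSemireg.Transfer
import Summits.Ventures.HSemireg.SheafSeed
import Summits.Ventures.HSemireg.Certificate
import Summits.Ventures.HSemireg.Leverage
import Summits.Ventures.HSemireg.UnionSeed
import HarnessLib

/-!
# Venture statement — HSemireg (cell `pub-hsemireg`): exact semiregularity maps for explicit cycles on CM abelian
# varieties, and what one semiregular representative closes

HONEST FRAMING (page 1 of every file of the cell). This venture COMPUTES — exactly, in rational / number-field arithmetic,
by two independent engines — Bloch's semiregularity map `π : H¹(Z, 𝒩_{Z/X}) → H^{p+1}(X, Ω^{p-1}_X)` (S. Bloch, Invent.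
Math. 17 (1972), §1) and the Buchweitz–Flenner partial semiregularity maps `σ_I` (Compositio Math. 137 (2003), §5) for
EXPLICIT representatives (local complete intersections `Z`, vector bundles `ℰ₀`) of Weil classes at CM points (`E^{2n}`,
`E` a CM elliptic curve, with the signature-`(n,n)` action of `K = ℚ(√-d)`), and decides injectivity. It is NOT a claim
about the Hodge conjecture: no case of the Hodge conjecture is asserted anywhere in `Summits/Ventures/HSemireg/`, every
published theorem enters as a hypothesis BY NAME (a `def … : Prop` of `Literature/`), and no number computed by the cell
appears in Lean except through the certificate contract below. This file is the INDEX (imports, this docstring, and the two 'any seed' theorems below); the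
statements of record are the declarations of the five imported modules, namespace `Summit.Ventures.HSemireg`.

## The target, in one paragraph

Bloch 1972, Remark (7.5): "The problem of constructing semi-regular representatives for algebraic cycle classes of
codimension `> 1` remains, however, wide open." Markman (2023–2025) settled the Weil classes of abelian FOURFOLDS of Weil
type and of SIXFOLDS of SPLIT Weil type (discriminant `-1`) through semiregular (twisted, reflexive) SHEAVES. TARGET
VERDICT of the cell: do Weil classes on abelian SIXFOLDS of Weil type — first of all on the NON-split components, open in
print — admit a semiregular ALGEBRAIC representative at a CM point (an integral semiregular local complete intersection,
or a vector bundle with injective partial semiregularity map and the right Chern character)? A YES at one anchor is, by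
the theorems indexed here, a case of the variational Hodge conjecture on the anchor's whole deformation component; a NO
census (which explicit families are never semiregular, with the kernel vector exhibited) is recorded as such.

## Statements of record (all in namespace `Summit.Ventures.HSemireg`; tree vocabulary, nothing re-declared)

* VERDICT SHAPES (`Transfer.lean`): `HasSemiregularWeilRepresentative n d` — some `√-d`-Weil abelian `2n`-fold anchor
  `(P, ψ₀, ι, a)` (`P.dim = 2n`, `ψ₀ ≫ ψ₀ = -d`) carries a non-zero rational `(n,n)` Weil class `w` and a Bloch seed
  `HasBlochSeedAt n P h_K w` (tree: an INTEGRAL closed lci `Z ↪ P` of codimension `n`, `IsBlochSemiregular`, `q·h_Kⁿ + w`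
  supported on `Z`; `h_K = symmetrisedClass d P ψ₀ ι a = d·ι^*a + ψ₀^*ι^*a`); `HasNonsplitSemiregularWeilRepresentative n d`
  — the same on an anchor NOT of hyperbolic (split) Weil type: the first open target at `n = 3`. Sheaf form
  (`SheafSeed.lean`): `HasBFSheafSeedAt C n I P h w` — a finite locally free `I`-semiregular `ℰ₀` (`IsISemiregular`, the
  tree's REAL `σ_q` on Mathlib's `Ext`) with `ch_n(ℰ₀) = q·hⁿ + w`, `ch_p(ℰ₀) = c_p·hᵖ` (`p ∈ I ∖ {n}`), on every model of `P`.
  Reducible-cycle form (`UnionSeed.lean`): `HasBlochUnionSeedAt n P h w` — a REDUCED lci `Z ↪ P` of codimension `n` whose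
  components are images of SMOOTH projective `K_j` (e.g. Schoen's `Δ_J ∪ (C × C) ⊂ J(C)²`, the cell's STEP-0 class (A)), with
  `q·hⁿ + w = μ·Σ_j ι_{j*}1` (the tree's REAL complex-orientation Gysin classes); transport fact
  `BlochSemiregularSpreadSmoothComponents` (Bloch (7.4)/(7.5) for reduced lci with smooth components, Literature).
* WHAT ONE SEED CLOSES (hypotheses BY NAME; transport facts REFEREED: `BlochSemiregularSpread` = Bloch (7.4)/(7.5) =
  Buchweitz–Flenner Thm. 5.2; `BuchweitzFlenner2003_variationalHodge_ISemiregular` = BF Thm. 5.1; reach facts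
  `weilFamilyReach_hyperbolic`, `weilFamilyReach_similar` = Deligne 1982, proof of Thm. 4.8, with van Geemen / Landherr):
  - the anchor's COMPONENT: `weilClasses_algebraic_of_similar_seed`, `…_of_similar_sheafSeed`, `…_of_similar_unionSeed` —
    the Weil plane of every `√-d`-Weil `2n`-fold Weil-similar to the seeded anchor is algebraic (`n, d ≥ 1`);
  - the SPLIT component from a split anchor: `weilClasses_algebraic_split_of_hyperbolic_seed` (`n = 2`: STEP-0 shape;
    `n = 3`: Markman 2025 Thm. 1.5.1 by Bloch's route), `…_of_hyperbolic_sheafSeed`, `…_of_hyperbolic_unionSeed`;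
  - LEVERAGE one dimension up, per `d` (`Leverage.lean`): `weilSixfolds_slice_of_eightfold_seed` — one seed on a split
    EIGHTFOLD (e.g. `E⁸`) at `d` ⟹ `WeilAlgebraicAll 3 d` (every `√-d` sixfold, every discriminant), through the tree's
    proved degeneration edge `stub_descend`; `weilFourfolds_slice_of_sixfold_seed`; general `weilAlgebraicAll_of_hyperbolic_seed_succ`.
* THE CERTIFICATE CONTRACT (`Certificate.lean`): `BlochPairingCoordinates i r j k L` — coordinates of the tree's
  `blochPairingMap` (the map `H^{m-1}(X, Ω^{m+1}_X) → H^{m-1}(Z, 𝒩^∨ ⊗ ω_Z)` that Bloch DUALISES to define `π`) and its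
  matrix `M` — the engine's modelling claim; `isBlochSemiregular_of_certificate(_map)` (`M₀·R₀ = 1` over `K ⊆ L` ⟹
  `IsBlochSemiregular`), `not_isBlochSemiregular_of_certificate(_map)` (`y₀ ≠ 0`, `y₀·M₀ = 0` ⟹ `¬ IsBlochSemiregular`),
  `isBlochSemiregular_of_sandwich` (a COMPOSITE `N·M` of full rank `b = h¹(Z, 𝒩)`, e.g. the transpose of `ξ ↦ ξ ∪ [Z]`,
  Bloch (2.5)/(6.8): `Q_L·(N·M·R) = 1` ⟹ `IsBlochSemiregular`). PROTOCOL: `L = ℂ`, both dimensions stated, certificate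
  entries exact in a number field `K ↪ ℂ`.

## The chain, arrow by arrow (status)

(S) the seed at ONE anchor — OPEN, the computation target · (B) transport `BlochSemiregularSpread (2n) n` / BF Thm. 5.1 —
REFEREED named facts (on-path: implied by the Hodge conjecture) · (L) seed ∧ transport ⟹ `WeilAnchorLocalClause` (local
variational Hodge conjecture at the anchor) — KERNEL (tree, and `weilAnchorLocalClause_of_BF_of_sheafSeedAt` here) · (G)
local ⟹ whole component — KERNEL (Cattani–Deligne–Kaplan / Charles–Schnell countable-union theorem discharged in the tree,
Baire, Lefschetz `(1,1)`, one Weil class suffices, isogeny transfer) · (R) Deligne's family through the anchor reaches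
every member of the component — REFEREED named facts. NOT on the path: density of CM points / André–Oort, finiteness of
Mumford–Tate types (nothing here aggregates components), and "HC at the CM point" as a hypothesis (the representative is
EXHIBITED; its class identity is part of the seed).

## What has NO Lean door (honest scope)

Perfect complexes and reflexive / twisted non-locally-free sheaves (Markman's secant sheaves; the cell's STEP-0b secant
complex): the tree has no real carriers for their semiregularity maps, so no sound transport fact can be typed for them
today; a verdict resting on such an object cites the printed transfer (Perry 2026 Thm. 1.1, preprint; Markman 2025 §7.5)
and is NOT kernel-composed. Local complete intersections with SINGULAR irreducible components or NON-REDUCED structure: no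
door yet (`Transfer.lean` takes `Z` integral, `UnionSeed.lean` takes `Z` reduced with smooth components; the general case
needs the resolution cycle classes / multiplicities on real carriers). Fully semiregular vector bundles with a `B`-field: the tree's door `hasLocallyAlgebraicWeilAnchor_of_perryTwisted_kappaAnchorObject` rests on the UNREFEREED
claim-fact `Perry2026_semiregularTwisted_remainsAlgebraic`.

## Why this is not one of the 21 summits

It is a computation (exact linear algebra on explicit CM abelian varieties) plus an index of already-typed transfer
theorems; its value is an OBJECT (a semiregular representative, certified) or a NEGATIVE CENSUS (kernel vectors), stated as
such. A positive instance would be consumed by the Hodge summit's own routes (`HasHyperbolicBlochSeed`, `HasCMBlochSeeds`,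
`WeilSixfolds`) through the theorems above; nothing here counts toward summit accounting.

## References (as printed; typed verbatim in the Literature files the modules cite)

S. Bloch, Invent. Math. 17 (1972) 51–66 (§1, (7.3)–(7.5)); R.-O. Buchweitz, H. Flenner, Compositio Math. 137 (2003) 135–210
(Def. 4.10, Thm. 5.1, 5.2, (8.1), Prop. 8.2); P. Deligne, LNM 900 (1982), Thm. 4.8; B. van Geemen, LNM 1594 (1994), 4.9,
5.2–5.11, 6.12; C. Schoen, Compositio Math. 114 (1998), §10; E. Markman, J. Eur. Math. Soc. (2023); arXiv:2502.03415 (2025),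
Thm. 1.5.1, Cor. 1.6.1, §7.5; F. Charles, C. Schnell, Notes on absolute Hodge classes (2014), Prop. 11.3.11.
-/

noncomputable section

open CategoryTheory AlgebraicGeometry

namespace Summit.Ventures.HSemireg

open Literature.AlgebraicGeometry Literature.AlgebraicGeometry.Motives
open Literature.AlgebraicGeometry.HodgeTheory
open Literature.AlgebraicTopology.SingularHomology
open Summit.HodgeConjecture.HodgeConjecture.WeilTypeLadder

/-- **Statement of record — the three object kinds of the cell, one conclusion.** For `n, d ≥ 1`, granting BY NAME
the refereed transport facts of the three doors (`BlochSemiregularSpread (2n) n` for integral lci seeds,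
`BlochSemiregularSpreadSmoothComponents (2n) n` for reduced lci seeds with smooth components,
`BuchweitzFlenner2003_variationalHodge_ISemiregular` for vector-bundle seeds) and Deligne's hyperbolic reach
`weilFamilyReach_hyperbolic`: if a SPLIT `√-d`-Weil anchor `(P, ψ₀, ι, a)` of dimension `2n` carries a non-zero rational
Weil class `w` and ANY ONE of the cell's certified objects for `q·h_Kⁿ + w` — an integral Bloch seed
(`HasBlochSeedAt`), a reduced union seed (`HasBlochUnionSeedAt`), or an `I`-semiregular vector bundle
(`HasBFSheafSeedAt C n I`) — then the Weil plane of EVERY split `√-d`-Weil abelian `2n`-fold is algebraic. (Case split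
over the three doors; each lands in the tree's `HasLocallyAlgebraicWeilAnchor n d` and the split-component engine
`weilClasses_algebraic_hyperbolic_of_localAnchor`.) Nothing asserted; `n = 2` is the STEP-0 shape, `n = 3` the first
target's split half, `n = 4` feeds `Leverage.lean`. [cite: Bloch1972Semiregularity, Thm. (7.4) and Remark (7.5)]
[cite: BuchweitzFlenner2003, Thm. 5.1 and Thm. 5.2] [cite: Deligne1982HodgeCycles, proof of Thm. 4.8] -/
theorem weilClasses_algebraic_split_of_any_seed (n d : ℕ) (hn : 1 ≤ n) (hd : 1 ≤ d)
    (hB : BlochSemiregularSpread (2 * n) n) (hB' : BlochSemiregularSpreadSmoothComponents (2 * n) n)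
    (hBF : BuchweitzFlenner2003_variationalHodge_ISemiregular) (hF : weilFamilyReach_hyperbolic)
    (P : AbelianVariety ℂ) (ψ₀ : P ⟶ P) (ι : ProjectiveEmbedding P.X) (a : complexBetti (projectiveSpace ι.n ℂ) 2)
    (w : complexBetti P.X (2 * n)) (hP : P.dim = 2 * n) (hψ : ψ₀ ≫ ψ₀ = -(d • 𝟙 P)) (ha : IsRationalClass a)
    (ha0 : a ≠ 0) (hhyp : IsHyperbolicWeilType P ψ₀ n (symmetrisedClass d P ψ₀ ι a))
    (hwW : w ∈ weilClassesOf P ψ₀ n d) (hwr : IsRationalClass w) (hw0 : w ≠ 0)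
    (hseed : HasBlochSeedAt n P (symmetrisedClass d P ψ₀ ι a) w ∨
      HasBlochUnionSeedAt n P (symmetrisedClass d P ψ₀ ι a) w ∨
      ∃ (C : ChernCharacterBetti) (I : Finset ℕ), HasBFSheafSeedAt C n I P (symmetrisedClass d P ψ₀ ι a) w)
    (A : AbelianVariety ℂ) (φ : A ⟶ A) (hA : A.dim = 2 * n) (hφ : φ ≫ φ = -(d • 𝟙 A))
    (eA : ProjectiveEmbedding A.X) (aA : complexBetti (projectiveSpace eA.n ℂ) 2) (haA : IsRationalClass aA)
    (haA0 : aA ≠ 0) (hhypA : IsHyperbolicWeilType A φ n (symmetrisedClass d A φ eA aA)) :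
    weilClassesOf A φ n d ≤ algebraicClasses A.X n := by
  have hloc : WeilAnchorLocalClause n d P (symmetrisedClass d P ψ₀ ι a) w := by
    rcases hseed with hS | hS | ⟨C, I, hS⟩
    · exact weilAnchorLocalClause_of_blochSpread_of_blochSeedAt d hB hS
    · exact weilAnchorLocalClause_of_blochSpreadSmoothComponents_of_unionSeedAt d hB' hS
    · exact weilAnchorLocalClause_of_BF_of_sheafSeedAt d C hBF hS
  exact weilClasses_algebraic_hyperbolic_of_localAnchor n d hn hd
    ((hasLocallyAlgebraicWeilAnchor_iff n d).2 ⟨P, ψ₀, ι, a, w, hP, hψ, ha, ha0, hhyp, hwW, hwr, hw0, hloc⟩)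
    hF A φ hA hφ eA aA haA haA0 hhypA

/-- **Statement of record — the anchor's own component, any of the three object kinds.** As
`weilClasses_algebraic_split_of_any_seed`, with Deligne's reach-by-similitude `weilFamilyReach_similar` in place of the
hyperbolic reach and no hyperbolicity: the Weil plane of every `√-d`-Weil `2n`-fold carrying a non-zero `(n,n)` Weil class
and Weil-similar to the seeded anchor is algebraic — at `n = 3` on a NON-split anchor, the cell's first open target.
[cite: Bloch1972Semiregularity, Thm. (7.4) and Remark (7.5)] [cite: BuchweitzFlenner2003, Thm. 5.1 and Thm. 5.2]
[cite: Deligne1982HodgeCycles, proof of Thm. 4.8] -/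
theorem weilClasses_algebraic_of_similar_any_seed {n d : ℕ} (hn : 1 ≤ n) (hd : 1 ≤ d)
    (hB : BlochSemiregularSpread (2 * n) n) (hB' : BlochSemiregularSpreadSmoothComponents (2 * n) n)
    (hBF : BuchweitzFlenner2003_variationalHodge_ISemiregular) (hF : weilFamilyReach_similar)
    (P : AbelianVariety ℂ) (ψ₀ : P ⟶ P) (ι : ProjectiveEmbedding P.X) (a : complexBetti (projectiveSpace ι.n ℂ) 2)
    (w : complexBetti P.X (2 * n)) (hP : P.dim = 2 * n) (hψ : ψ₀ ≫ ψ₀ = -(d • 𝟙 P)) (ha : IsRationalClass a)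
    (ha0 : a ≠ 0) (hwW : w ∈ weilClassesOf P ψ₀ n d) (hwr : IsRationalClass w) (hw0 : w ≠ 0)
    (hwH : IsOfHodgeType (2 * n) P.X (2 * n) n n w)
    (hseed : HasBlochSeedAt n P (symmetrisedClass d P ψ₀ ι a) w ∨
      HasBlochUnionSeedAt n P (symmetrisedClass d P ψ₀ ι a) w ∨
      ∃ (C : ChernCharacterBetti) (I : Finset ℕ), HasBFSheafSeedAt C n I P (symmetrisedClass d P ψ₀ ι a) w)
    (A : AbelianVariety ℂ) (φ : A ⟶ A) (hA : A.dim = 2 * n) (hφ : φ ≫ φ = -(d • 𝟙 A))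
    (hWA : ∃ wA : complexBetti A.X (2 * n),
      wA ∈ weilClassesOf A φ n d ∧ wA ≠ 0 ∧ IsOfHodgeType (2 * n) A.X (2 * n) n n wA)
    (eA : ProjectiveEmbedding A.X) (aA : complexBetti (projectiveSpace eA.n ℂ) 2) (haA : IsRationalClass aA)
    (haA0 : aA ≠ 0)
    (hsim : IsWeilSimilar n P ψ₀ (symmetrisedClass d P ψ₀ ι a) A φ (symmetrisedClass d A φ eA aA)) :
    weilClassesOf A φ n d ≤ algebraicClasses A.X n := by
  have hloc : WeilAnchorLocalClause n d P (symmetrisedClass d P ψ₀ ι a) w := by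
    rcases hseed with hS | hS | ⟨C, I, hS⟩
    · exact weilAnchorLocalClause_of_blochSpread_of_blochSeedAt d hB hS
    · exact weilAnchorLocalClause_of_blochSpreadSmoothComponents_of_unionSeedAt d hB' hS
    · exact weilAnchorLocalClause_of_BF_of_sheafSeedAt d C hBF hS
  exact weilClassesOf_le_algebraicClasses_of_reachSimilar_of_similarAnchor hF hn hd A φ hA hφ hWA
    ⟨eA, aA, P, ψ₀, ι, a, w, haA, haA0, hP, hψ, ha, ha0, hwW, hwr, hw0, hwH, hloc, hsim⟩

end Summit.Ventures.HSemireg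

end
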